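import Mathlib
import Literature.Computability.AlgebraicComplexity.LocalStrongUSP
import Literature.Computability.AlgebraicComplexity.GroupTheoreticMatMulThmBProofs
import Literature.Computability.AlgebraicComplexity.PrattTrapezoidValSTPP
import Literature.Computability.AlgebraicComplexity.PrattTrapezoidValBounds

/-!
# Solo-blind seat, s42: Pratt's `Val(ℤ/nℤ)` exceeds `n` — local strong USPs with coprime mixed moduli

Companion to `paper/SHARPEST.md` §2C(a) / §3 Q12 (solo-blind seat `solo-MatrixMultiplication-blind`,
session s42, 2026-08-27).

K. Pratt (arXiv:2309.03878, Def. 3.2, Prop. 3.4, Conj. 4.1) introduced `Val(G)`, the maximum number of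
solutions of `a + b + c = 0` over equilateral-trapezoid-free triples `(A, B, C)` of subsets of `G`
(tree: `prattVal`), proved `|G| ≤ Val(G) ≤ |G|^{3/2}`, and conjectured `Val(ℤ/nℤ) ≤ n^{1+o(1)}`
(Conj. 4.1, the weakest of his barrier conjectures for the group-theoretic approach).  For CYCLIC groups
no lower bound beyond the trivial `n ≤ Val(ℤ/nℤ)` is recorded in print (Pratt, §3: "STPP constructions
are essentially the only approach we know of for proving lower bounds on `Val(G)`"; §4.1: for the planar
relaxations "the best lower bound that we know … is `Ω(n)`").

OBSERVATION certified here.  Cohn–Kleinberg–Szegedy–Umans' Theorem 33 (local strong USP `U` of width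
`k` ⟹ the coordinate-support triples `(A_u, B_u, C_u)_{u ∈ U}` form an STPP family in `Cyc_ℓ^k`; tree:
`CohnKleinbergSzegedyUmans2005_thm33_holds`) holds VERBATIM when the `k` coordinates live in `k`
DIFFERENT abelian groups `K₁, …, K_k` (the printed proof is coordinatewise).  With pairwise coprime
moduli the ambient group `ℤ/m₁ × ⋯ × ℤ/m_k` is the cyclic group `ℤ/(m₁⋯m_k)` (CRT), so by Pratt's
Prop. 3.3 (tree: `sum_card_mul_le_prattVal_of_addSimultaneousTPP`)

  `Val(ℤ/(m₁ ⋯ m_k)ℤ) ≥ |U| · ∏ⱼ (mⱼ − 1)`.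

Consequences: `Val(ℤ/140ℤ) ≥ 144 > 140` (width `3`, `|U| = 2`, moduli `4, 5, 7`: the first recorded
cyclic group in which Pratt's quantity exceeds the trivial bound), `Val(ℤ/280ℤ) ≥ 336 = 1.2 · 280`, and
`Val(ℤ/nℤ)/n` is UNBOUNDED (blocks of three fresh primes and Pratt's super-multiplicativity Prop. 3.5,
tree `prattVal_zmod_mul_le`): Conjecture 4.1 cannot be sharpened to `Val(ℤ/nℤ) = O(n)`.  (Pen side,
SHARPEST §3 Q12: with CKSU Props. 3.8/34 the same mechanism gives
`Val(ℤ/nℤ) ≥ n · exp(c · log n / log log n)`; these coordinate constructions never exceed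
`n^{1 + O(1/log log n)}`, so they are consistent with Conj. 4.1.)

Kernel-checked:
* `soloVal_isSTPP_usp_mixed` — CKSU Thm. 33 over `Π j, K j` with mixed coordinate groups;
* `soloVal_card_filter_support`, `soloVal_prod_three` — `|A_u||B_u||C_u| = ∏ⱼ (|Kⱼ| − 1)`;
* `soloVal_le_prattVal_pi_of_isLocalStrongUSP` — `|U| · ∏ⱼ (|Kⱼ| − 1) ≤ Val(Πⱼ Kⱼ)`;
* `soloVal_le_prattVal_zmod_of_isLocalStrongUSP` — the cyclic (CRT) form;
* `soloVal_isLocalStrongUSP_axesPair` — the width-3 local strong USP `{123, 231}`;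
* `soloVal_prattVal_zmod140`, `soloVal_card_lt_prattVal_zmod140`, `soloVal_prattVal_zmod280`;
* `soloVal_primeBlock`, `soloVal_tower`, `soloVal_prattVal_zmod_unbounded` — `∀ M ∃ n, M·n ≤ Val(ℤ/nℤ)`.

References: [Pratt2024] K. Pratt, arXiv:2309.03878, Def. 3.2, Props. 3.3–3.5, Conj. 4.1;
[CohnKleinbergSzegedyUmans2005] arXiv:math/0511460, §6.1, Thm. 33, Prop. 34.
-/

set_option linter.dupNamespace false

namespace Summit.MatrixMultiplication.MatrixMultiplication.Theorems

open Finset Literature.Computability.AlgebraicComplexity Literature.Combinatorics.Additive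

/-- Every element of `Fin 3` is `0`, `1` or `2`. -/
private theorem soloVal_fin3_cases (a : Fin 3) : a = 0 ∨ a = 1 ∨ a = 2 := by
  revert a
  decide

section Mixed

variable {k L : ℕ} {K : Fin k → Type*} [∀ j, AddCommGroup (K j)] [∀ j, DecidableEq (K j)]

omit [∀ j, DecidableEq (K j)] in
/-- **CKSU Theorem 33 with mixed coordinate groups.**  For a local strong USP `row` of `L` rows and
width `k` and abelian groups `K₀, …, K_{k-1}`, the families `A_a = {x : x_j ≠ 0 ↔ row a j = 1}`,
`B_a = {x : x_j ≠ 0 ↔ row a j = 2}`, `C_a = {x : x_j ≠ 0 ↔ row a j = 3}` (symbols coded `0,1,2`;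
sets given by membership hypotheses) in `Πⱼ Kⱼ` satisfy the simultaneous triple product property.
The proof is the printed (coordinatewise) one, cf. `CohnKleinbergSzegedyUmans2005_thm33_holds`. -/
theorem soloVal_isSTPP_usp_mixed {row : Fin L → Fin k → Fin 3} (hU : IsLocalStrongUSP row)
    {A B C : Fin L → Finset (Π j, K j)}
    (hA : ∀ a x, x ∈ A a ↔ ∀ j, x j ≠ 0 ↔ row a j = 0)
    (hB : ∀ a x, x ∈ B a ↔ ∀ j, x j ≠ 0 ↔ row a j = 1)
    (hC : ∀ a x, x ∈ C a ↔ ∀ j, x j ≠ 0 ↔ row a j = 2) :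
    IsSTPP A B C := by
  intro i j kk s hs s' hs' t ht t' ht' u hu u' hu' hsum
  rw [hA] at hs hs'
  rw [hB] at ht ht'
  rw [hC] at hu hu'
  -- the relation, coordinate by coordinate
  have hc : ∀ c : Fin k, s' c - s c + (t' c - t c) + (u' c - u c) = 0 := fun c => by
    have e := congrFun hsum c
    simpa only [Pi.add_apply, Pi.sub_apply, Pi.zero_apply] using e
  -- (1) simultaneity
  have hijk : i = j ∧ j = kk := by
    by_contra hne
    have hne' : j ≠ kk ∨ kk ≠ i := by
      rcases eq_or_ne j kk with hjk | hjk
      · right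
        intro hki
        exact hne ⟨by rw [← hki, ← hjk], hjk⟩
      · exact Or.inl hjk
    obtain ⟨c, hpat⟩ := hU j kk i hne'
    have h1 := hs c
    have h2 := hs' c
    have h3 := ht c
    have h4 := ht' c
    have h5 := hu c
    have h6 := hu' c
    have e := hc c
    simp only [localStrongUSPPatterns, Finset.mem_insert, Finset.mem_singleton, Prod.mk.injEq]
      at hpat
    rcases hpat with ⟨hj, hk, hi⟩ | ⟨hj, hk, hi⟩ | ⟨hj, hk, hi⟩ | ⟨hj, hk, hi⟩ | ⟨hj, hk, hi⟩ |
        ⟨hj, hk, hi⟩ <;>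
      simp only [hj, hk, hi, Fin.isValue, Fin.reduceEq, iff_true, iff_false, ne_eq,
        not_not] at h1 h2 h3 h4 h5 h6 <;>
      simp only [h1, h2, h3, h4, h5, h6, sub_zero, zero_sub, add_zero, zero_add, neg_eq_zero,
        sub_self] at e
  -- (2) the triple product property of the single triple
  obtain ⟨hij, hjk⟩ := hijk
  subst kk
  subst j
  refine ⟨rfl, rfl, ?_, ?_, ?_⟩ <;> funext c <;>
    rcases soloVal_fin3_cases (row i c) with h | h | h <;>
  ( have h1 := hs c
    have h2 := hs' c
    have h3 := ht c
    have h4 := ht' c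
    have h5 := hu c
    have h6 := hu' c
    have e := hc c
    simp only [h, Fin.isValue, Fin.reduceEq, iff_true, iff_false, ne_eq, not_not]
      at h1 h2 h3 h4 h5 h6
    first
      | rw [h1, h2]
      | rw [h3, h4]
      | rw [h5, h6]
      | (simp only [h1, h2, h3, h4, h5, h6, add_zero, zero_add, sub_self, sub_eq_zero] at e
         exact e.symm) )

variable [∀ j, Fintype (K j)]

/-- Cardinality of a coordinate-support set: `#{x ∈ Πⱼ Kⱼ : x_j ≠ 0 ↔ P j} = ∏ⱼ (|Kⱼ| − 1)^{[P j]}`. -/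
theorem soloVal_card_filter_support (P : Fin k → Prop) [DecidablePred P] :
    #(univ.filter fun x : (Π j, K j) => ∀ j, x j ≠ 0 ↔ P j) =
      ∏ j, (if P j then Fintype.card (K j) - 1 else 1) := by
  have hset : (univ.filter fun x : (Π j, K j) => ∀ j, x j ≠ 0 ↔ P j) =
      Fintype.piFinset fun j => if P j then univ.erase (0 : K j) else {0} := by
    ext x
    simp only [mem_filter, mem_univ, true_and, Fintype.mem_piFinset]
    refine forall_congr' fun j => ?_
    by_cases hP : P j
    · simp [hP]
    · simp [hP]
  rw [hset, Fintype.card_piFinset]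
  refine Finset.prod_congr rfl fun j _ => ?_
  by_cases hP : P j
  · simp [hP, Finset.card_erase_of_mem]
  · simp [hP]

/-- The three coordinate-support cardinalities of one row multiply to `∏ⱼ f j`
(every coordinate carries exactly one of the three symbols). -/
theorem soloVal_prod_three (row : Fin L → Fin k → Fin 3) (a : Fin L) (f : Fin k → ℕ) :
    (∏ j, if row a j = 0 then f j else 1) * (∏ j, if row a j = 1 then f j else 1) *
      (∏ j, if row a j = 2 then f j else 1) = ∏ j, f j := by
  rw [← Finset.prod_mul_distrib, ← Finset.prod_mul_distrib]
  refine Finset.prod_congr rfl fun j _ => ?_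
  rcases soloVal_fin3_cases (row a j) with h | h | h <;> simp [h]

/-- **Local strong USPs bound Pratt's `Val` of a product of `k` finite abelian groups:**
`|U| · ∏ⱼ (|Kⱼ| − 1) ≤ Val(Πⱼ Kⱼ)` (CKSU Thm. 33 with mixed coordinates + Pratt Prop. 3.3). -/
theorem soloVal_le_prattVal_pi_of_isLocalStrongUSP {row : Fin L → Fin k → Fin 3}
    (hU : IsLocalStrongUSP row) :
    L * ∏ j, (Fintype.card (K j) - 1) ≤ prattVal (Π j, K j) := by
  have hS : IsSTPP
      (fun a => univ.filter fun x : (Π j, K j) => ∀ j, x j ≠ 0 ↔ row a j = 0)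
      (fun a => univ.filter fun x : (Π j, K j) => ∀ j, x j ≠ 0 ↔ row a j = 1)
      (fun a => univ.filter fun x : (Π j, K j) => ∀ j, x j ≠ 0 ↔ row a j = 2) :=
    soloVal_isSTPP_usp_mixed hU
      (fun a x => by simp only [mem_filter, mem_univ, true_and])
      (fun a x => by simp only [mem_filter, mem_univ, true_and])
      (fun a x => by simp only [mem_filter, mem_univ, true_and])
  have hS' := (isSTPP_iff_addSimultaneousTPP _ _ _).1 hS
  have h := sum_card_mul_le_prattVal_of_addSimultaneousTPP hS'
  have hterm : ∀ a : Fin L,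
      #(univ.filter fun x : (Π j, K j) => ∀ j, x j ≠ 0 ↔ row a j = 0) *
        #(univ.filter fun x : (Π j, K j) => ∀ j, x j ≠ 0 ↔ row a j = 1) *
        #(univ.filter fun x : (Π j, K j) => ∀ j, x j ≠ 0 ↔ row a j = 2) =
      ∏ j, (Fintype.card (K j) - 1) := by
    intro a
    rw [soloVal_card_filter_support (fun j => row a j = 0),
      soloVal_card_filter_support (fun j => row a j = 1),
      soloVal_card_filter_support (fun j => row a j = 2)]
    exact soloVal_prod_three row a _
  simp only [hterm, Finset.sum_const, Finset.card_univ, Fintype.card_fin, smul_eq_mul] at h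
  exact h

end Mixed

/-- **Cyclic form (CRT).**  For a local strong USP of `L` rows and width `k` and pairwise coprime moduli
`m₀, …, m_{k-1} ≥ 1` with `n = ∏ⱼ mⱼ`: `L · ∏ⱼ (mⱼ − 1) ≤ Val(ℤ/nℤ)`. -/
theorem soloVal_le_prattVal_zmod_of_isLocalStrongUSP {k L : ℕ} {row : Fin L → Fin k → Fin 3}
    (hU : IsLocalStrongUSP row) (m : Fin k → ℕ) (hm0 : ∀ j, m j ≠ 0)
    (hm : Pairwise (Function.onFun Nat.Coprime m)) (n : ℕ) [NeZero n] (hn : n = ∏ j, m j) :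
    L * ∏ j, (m j - 1) ≤ prattVal (ZMod n) := by
  haveI : ∀ j, NeZero (m j) := fun j => ⟨hm0 j⟩
  have e : ZMod n ≃+ (Π j, ZMod (m j)) :=
    ((ZMod.ringEquivCongr hn).trans (ZMod.prodEquivPi m hm)).toAddEquiv
  rw [prattVal_congr e]
  have h := soloVal_le_prattVal_pi_of_isLocalStrongUSP (K := fun j => ZMod (m j)) hU
  simpa only [ZMod.card] using h

/-- The width-3 local strong USP `{123, 231}` (two rows), i.e. CKSU's pair of punctured-axes triples. -/
theorem soloVal_isLocalStrongUSP_axesPair :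
    IsLocalStrongUSP ![![(0 : Fin 3), 1, 2], ![(1 : Fin 3), 2, 0]] := by
  unfold IsLocalStrongUSP localStrongUSPPatterns
  decide

/-- **`Val(ℤ/140ℤ) ≥ 144`** (moduli `4, 5, 7`; `2 · 3 · 4 · 6 = 144`). -/
theorem soloVal_prattVal_zmod140 : 144 ≤ prattVal (ZMod 140) := by
  have hm : Pairwise (Function.onFun Nat.Coprime ![4, 5, 7]) := by
    unfold Pairwise; decide
  have h := soloVal_le_prattVal_zmod_of_isLocalStrongUSP soloVal_isLocalStrongUSP_axesPair
    ![4, 5, 7] (by decide) hm 140 (by decide)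
  have h72 : ∏ j : Fin 3, (![4, 5, 7] j - 1) = 72 := by decide
  rw [h72] at h
  omega

/-- **Pratt's quantity exceeds the trivial bound in a cyclic group:** `|ℤ/140ℤ| = 140 < 144 ≤ Val(ℤ/140ℤ)`. -/
theorem soloVal_card_lt_prattVal_zmod140 : Fintype.card (ZMod 140) < prattVal (ZMod 140) := by
  rw [ZMod.card]
  exact lt_of_lt_of_le (by norm_num) soloVal_prattVal_zmod140

/-- **`Val(ℤ/280ℤ) ≥ 336 = 1.2 · 280`** (moduli `5, 7, 8`). -/
theorem soloVal_prattVal_zmod280 : 336 ≤ prattVal (ZMod 280) := by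
  have hm : Pairwise (Function.onFun Nat.Coprime ![5, 7, 8]) := by
    unfold Pairwise; decide
  have h := soloVal_le_prattVal_zmod_of_isLocalStrongUSP soloVal_isLocalStrongUSP_axesPair
    ![5, 7, 8] (by decide) hm 280 (by decide)
  have h72 : ∏ j : Fin 3, (![5, 7, 8] j - 1) = 168 := by decide
  rw [h72] at h
  omega

/-- **Prime block.**  For three distinct primes `p, q, r ≥ 11`: `5 · pqr ≤ 4 · Val(ℤ/pqrℤ)`
(`2(p−1)(q−1)(r−1) ≥ 2 (10/11)³ pqr ≥ (5/4) pqr`). -/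
theorem soloVal_primeBlock (p q r : ℕ) (hp : p.Prime) (hq : q.Prime) (hr : r.Prime)
    (hpq : p ≠ q) (hqr : q ≠ r) (hpr : p ≠ r) (h11p : 11 ≤ p) (h11q : 11 ≤ q) (h11r : 11 ≤ r)
    [NeZero (p * q * r)] :
    5 * (p * q * r) ≤ 4 * prattVal (ZMod (p * q * r)) := by
  have hm : Pairwise (Function.onFun Nat.Coprime ![p, q, r]) := by
    intro i j hij
    fin_cases i <;> fin_cases j <;>
      simp_all [Function.onFun, Nat.coprime_primes, ne_comm]
  have hm0 : ∀ j, ![p, q, r] j ≠ 0 := by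
    intro j
    fin_cases j <;> simp <;> omega
  have h := soloVal_le_prattVal_zmod_of_isLocalStrongUSP soloVal_isLocalStrongUSP_axesPair
    ![p, q, r] hm0 hm (p * q * r) (by simp [Fin.prod_univ_succ, mul_assoc])
  have h72 : ∏ j : Fin 3, (![p, q, r] j - 1) = (p - 1) * (q - 1) * (r - 1) := by
    simp [Fin.prod_univ_succ, mul_assoc]
  rw [h72] at h
  have h1 : 10 * p ≤ 11 * (p - 1) := by omega
  have h2 : 10 * q ≤ 11 * (q - 1) := by omega
  have h3 : 10 * r ≤ 11 * (r - 1) := by omega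
  have h4 : (10 * p) * (10 * q) * (10 * r) ≤ (11 * (p - 1)) * (11 * (q - 1)) * (11 * (r - 1)) :=
    Nat.mul_le_mul (Nat.mul_le_mul h1 h2) h3
  set X := (p - 1) * (q - 1) * (r - 1) with hX
  set Y := p * q * r with hY
  have h5 : 1000 * Y ≤ 1331 * X := by
    have e1 : (10 * p) * (10 * q) * (10 * r) = 1000 * Y := by rw [hY]; ring
    have e2 : (11 * (p - 1)) * (11 * (q - 1)) * (11 * (r - 1)) = 1331 * X := by rw [hX]; ring
    rw [e1, e2] at h4
    exact h4
  omega

/-- **Tower.**  For every `t` there is `n ≥ 1` with `(5/4)^t · n ≤ Val(ℤ/nℤ)`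
(super-multiplicativity over `t` blocks of fresh primes). -/
theorem soloVal_tower (t : ℕ) : ∃ n : ℕ, 5 ^ t * (n + 1) ≤ 4 ^ t * prattVal (ZMod (n + 1)) := by
  induction t with
  | zero =>
    refine ⟨0, ?_⟩
    have h := card_le_prattVal (G := ZMod 1)
    rw [ZMod.card] at h
    simpa using h
  | succ t ih =>
    obtain ⟨n, hn⟩ := ih
    obtain ⟨p, hp1, hp⟩ := Nat.exists_infinite_primes (n + 12)
    obtain ⟨q, hq1, hq⟩ := Nat.exists_infinite_primes (p + 1)
    obtain ⟨r, hr1, hr⟩ := Nat.exists_infinite_primes (q + 1)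
    have hpq : p ≠ q := by omega
    have hqr : q ≠ r := by omega
    have hpr : p ≠ r := by omega
    -- coprimality of `n + 1` with the three fresh primes
    have hcop : ∀ s : ℕ, s.Prime → n + 1 < s → Nat.Coprime (n + 1) s := by
      intro s hs hlt
      rw [Nat.coprime_comm, Nat.Prime.coprime_iff_not_dvd hs]
      intro hdvd
      exact absurd (Nat.le_of_dvd (Nat.succ_pos n) hdvd) (by omega)
    have hc : Nat.Coprime (n + 1) (p * q * r) :=
      Nat.Coprime.mul_right (Nat.Coprime.mul_right (hcop p hp (by omega)) (hcop q hq (by omega)))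
        (hcop r hr (by omega))
    have hpos : 0 < p * q * r := Nat.mul_pos (Nat.mul_pos hp.pos hq.pos) hr.pos
    haveI : NeZero (p * q * r) := ⟨hpos.ne'⟩
    have hblock := soloVal_primeBlock p q r hp hq hr hpq hqr hpr (by omega) (by omega) (by omega)
    have hmul := prattVal_zmod_mul_le (m := n + 1) (n := p * q * r) hc
    -- the new modulus, written as a successor
    refine ⟨(n + 1) * (p * q * r) - 1, ?_⟩
    have hN : (n + 1) * (p * q * r) - 1 + 1 = (n + 1) * (p * q * r) := by
      have : 1 ≤ (n + 1) * (p * q * r) := Nat.mul_pos (Nat.succ_pos n) hpos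
      omega
    have hcongr : prattVal (ZMod ((n + 1) * (p * q * r) - 1 + 1)) =
        prattVal (ZMod ((n + 1) * (p * q * r))) :=
      prattVal_congr (ZMod.ringEquivCongr hN).toAddEquiv
    rw [hcongr, hN]
    have hprod := Nat.mul_le_mul hn hblock
    -- 5^t (n+1) · 5 pqr ≤ 4^t V(n+1) · 4 V(pqr) ≤ 4^{t+1} V((n+1) pqr)
    calc 5 ^ (t + 1) * ((n + 1) * (p * q * r))
        = 5 ^ t * (n + 1) * (5 * (p * q * r)) := by ring
      _ ≤ 4 ^ t * prattVal (ZMod (n + 1)) * (4 * prattVal (ZMod (p * q * r))) := hprod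
      _ = 4 ^ (t + 1) * (prattVal (ZMod (n + 1)) * prattVal (ZMod (p * q * r))) := by ring
      _ ≤ 4 ^ (t + 1) * prattVal (ZMod ((n + 1) * (p * q * r))) :=
          Nat.mul_le_mul_left _ hmul

/-- **`Val(ℤ/nℤ)/n` is unbounded:** for every `M` there is `n ≥ 1` with `M · n ≤ Val(ℤ/nℤ)`.
In particular Pratt's Conjecture 4.1 (`Val(ℤ/nℤ) ≤ n^{1+o(1)}`) cannot be improved to `O(n)`. -/
theorem soloVal_prattVal_zmod_unbounded (M : ℕ) :
    ∃ n : ℕ, M * (n + 1) ≤ prattVal (ZMod (n + 1)) := by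
  obtain ⟨n, hn⟩ := soloVal_tower (4 * M)
  refine ⟨n, ?_⟩
  -- `4^{4M} · M ≤ 5^{4M}`: `256^M · M ≤ 256^M · 2^M = 512^M ≤ 625^M`
  have hM : 4 ^ (4 * M) * M ≤ 5 ^ (4 * M) := by
    rw [pow_mul, pow_mul]
    norm_num
    calc 256 ^ M * M ≤ 256 ^ M * 2 ^ M :=
          Nat.mul_le_mul_left _ (Nat.lt_two_pow_self).le
      _ = 512 ^ M := by rw [← mul_pow]; norm_num
      _ ≤ 625 ^ M := Nat.pow_le_pow_left (by norm_num) M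
  have h1 : 4 ^ (4 * M) * (M * (n + 1)) ≤ 4 ^ (4 * M) * prattVal (ZMod (n + 1)) :=
    calc 4 ^ (4 * M) * (M * (n + 1)) = 4 ^ (4 * M) * M * (n + 1) := by ring
      _ ≤ 5 ^ (4 * M) * (n + 1) := Nat.mul_le_mul_right _ hM
      _ ≤ 4 ^ (4 * M) * prattVal (ZMod (n + 1)) := hn
  exact Nat.le_of_mul_le_mul_left h1 (by positivity)

end Summit.MatrixMultiplication.MatrixMultiplication.Theorems
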